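import Summits.Ventures.LatticeQCDFlow.Scoring.TorusClustering2D
import Summits.Ventures.LatticeQCDFlow.Scoring.InfiniteVolumeLimit2D
import HarnessLib

/-!
# The exact non-abelian area law in two dimensions, V-t: the infinite-volume state — EXACT decorrelation of separated local observables and exponential clustering with every mass

HONEST FRAMING: exact (Metropolis-corrected) sampling algorithms for lattice gauge theory;
figures of merit are autocorrelation/cost numbers at stated couplings and volumes; no
continuum-physics claim.

Venture `LatticeQCDFlow` (cell pub-lqcd), sub-topic `Scoring`; FANOUT row 5 (`s0-sun-a`), GEN-22.
NEW WORK of the cell (placement rule).  Part V-k (`InfiniteVolumeLimit2D`): in `d = 2`, for every compact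
second-countable `G`, continuous `ρ` and EVERY real `β`, the torus Wilson states have a unique infinite-volume
limit `μ_β` (`infiniteVolumeLimitPoints ρ β = {μ_β}`), representing the limits of all bounded measurable cylinder
observables.  Parts V-r/V-s (`TorusCovarianceDecay2D`, `TorusClustering2D`) bound the torus covariances.  Passing
to the limit (`Literature…LatticeGaugeProofs.abs_covariance_le_of_eventually`):

* §1 **`covariance_eq_zero_of_col_sep`**, **`covariance_eq_zero_of_row_sep`** — for bounded continuous cylinder
  observables `Fa`, `Fb` whose support boxes are separated by at least one column (row) of plaquettes,
  `cov_{μ_β}(Fa, Fb) = 0`: IN THE INFINITE-VOLUME TWO-DIMENSIONAL YANG–MILLS STATE, LOCAL OBSERVABLES A COLUMN OR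
  A ROW APART ARE EXACTLY UNCORRELATED (every compact `G`, every `β`; no gauge invariance asked);
  **`covariance_comp_configShift_eq_zero`** — hence `cov_{μ_β}(F₁, F₂ ∘ θ_x) = 0` as soon as the translate
  `x` separates the support boxes (explicit thresholds): FINITE-RANGE DEPENDENCE of the local observables.
* §2 **`hasExponentialDecayRate_covariance_two`** — for every `m > 0`:
  `HasExponentialDecayRate (x ↦ cov_{μ_β}(F₁, F₂ ∘ θ_x)) m`, the clustering clause (iii) of
  `Literature…osterwalder_seiler_strongCoupling` (there: `0 ≤ β < β₀`, gauge-invariant observables, some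
  `m(β)`), in `d = 2` for EVERY `β`, EVERY mass and ALL bounded continuous local observables.

No `def`, nothing cited as a fact, 0 sorry.
-/

noncomputable section

open MeasureTheory ProbabilityTheory Function Finset Filter Topology
open Literature.MathematicalPhysics.QuantumFieldTheory
open Literature.MathematicalPhysics.QuantumLattice
open Summit.Ventures.LatticeQCDFlow.Theory2.Lattice
open Summit.Ventures.LatticeQCDFlow.Theory2.Lattice.TwoDim

namespace Summit.Ventures.LatticeQCDFlow.Scoring

variable {G : Type*} [Group G] [TopologicalSpace G] [IsTopologicalGroup G]
  [CompactSpace G] [T2Space G] [SecondCountableTopology G] [MeasurableSpace G] [BorelSpace G] {N : ℕ}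
  (ρ : G →* Matrix (Fin N) (Fin N) ℂ)

/-- Every infinite-volume limit point in two dimensions represents the limits of the torus expectations of all
bounded measurable cylinder observables (part V-k, through uniqueness). -/
theorem tendsto_wilsonExpectation_of_mem_two (hρ : Continuous ρ) {β : ℝ} {μ : Measure (LGConfig 2 G)}
    (hμ : μ ∈ infiniteVolumeLimitPoints ρ β) :
    ∀ (F : LGConfig 2 G → ℝ) (S : Finset ((Literature.MathematicalPhysics.QuantumLattice.ZdEdge 2))),
      IsCylinder F S → Measurable F → (∃ C, ∀ U, |F U| ≤ C) →
        Tendsto (fun L : ℕ => wilsonExpectation (L := L + 1) ρ β (toTorusObservable (L + 1) F))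
          atTop (𝓝 (∫ U, F U ∂μ)) := by
  obtain ⟨μ₀, -, -, huniq, hid, -⟩ := exists_infiniteVolumeLimit_two ρ hρ β
  rw [huniq, Set.mem_singleton_iff] at hμ
  subst hμ
  exact hid

/-! ## §1. Exact decorrelation of separated local observables in the infinite-volume state -/

section Exact

/-- The covariance is the limit of the torus covariances (bounded continuous cylinder observables). -/
theorem tendsto_cov_of_mem_two (hρ : Continuous ρ) {β : ℝ} {μ : Measure (LGConfig 2 G)}
    (hμ : μ ∈ infiniteVolumeLimitPoints ρ β) {Fa Fb : LGConfig 2 G → ℝ}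
    {Sa Sb : Finset ((Literature.MathematicalPhysics.QuantumLattice.ZdEdge 2))} (hFa : IsCylinder Fa Sa)
    (hFb : IsCylinder Fb Sb) (hca : Continuous Fa) (hcb : Continuous Fb) {Ca Cb : ℝ}
    (hba : ∀ U, |Fa U| ≤ Ca) (hbb : ∀ U, |Fb U| ≤ Cb) :
    Tendsto (fun L : ℕ =>
        wilsonExpectation (L := L + 1) ρ β
            (fun U => toTorusObservable (L + 1) Fa U * toTorusObservable (L + 1) Fb U) -
          wilsonExpectation (L := L + 1) ρ β (toTorusObservable (L + 1) Fa) *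
            wilsonExpectation (L := L + 1) ρ β (toTorusObservable (L + 1) Fb))
      atTop (𝓝 (cov[Fa, Fb; μ])) := by
  obtain ⟨μ₀, hprob, -, huniq, -, -⟩ := exists_infiniteVolumeLimit_two ρ hρ β
  have hμ' := hμ
  rw [huniq, Set.mem_singleton_iff] at hμ'
  subst hμ'
  have hid := tendsto_wilsonExpectation_of_mem_two ρ hρ hμ
  have hma : Measurable Fa := hca.measurable
  have hmb : Measurable Fb := hcb.measurable
  have hP : IsCylinder (fun U => Fa U * Fb U) _ := IsCylinder.mul hFa hFb
  have hbP : ∀ U, |Fa U * Fb U| ≤ Ca * Cb := fun U => by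
    rw [abs_mul]
    exact mul_le_mul (hba U) (hbb U) (abs_nonneg _) ((abs_nonneg _).trans (hba U))
  have t1 := hid _ _ hP (hma.mul hmb) ⟨Ca * Cb, hbP⟩
  have t2 := hid Fa Sa hFa hma ⟨Ca, hba⟩
  have t3 := hid Fb Sb hFb hmb ⟨Cb, hbb⟩
  have hcov : cov[Fa, Fb; μ] = ∫ U, Fa U * Fb U ∂μ - (∫ U, Fa U ∂μ) * ∫ U, Fb U ∂μ := by
    have l₁ : MemLp Fa 2 μ := MemLp.of_bound hma.aestronglyMeasurable Ca
      (ae_of_all _ fun U => by simpa [Real.norm_eq_abs] using hba U)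
    have l₂ : MemLp Fb 2 μ := MemLp.of_bound hmb.aestronglyMeasurable Cb
      (ae_of_all _ fun U => by simpa [Real.norm_eq_abs] using hbb U)
    exact covariance_eq_sub l₁ l₂
  rw [hcov]
  exact t1.sub (t2.mul t3)

/-- **LOCAL OBSERVABLES A COLUMN APART ARE EXACTLY UNCORRELATED IN THE INFINITE-VOLUME STATE** (`d = 2`, every
compact `G`, continuous `ρ`, every real `β`): bounded continuous cylinder observables whose support boxes
(columns `[a, a + Ra)` and `[a', a' + Rb)`) satisfy `a + Ra + 1 ≤ a'` have `cov_{μ_β}(Fa, Fb) = 0`. -/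
theorem covariance_eq_zero_of_col_sep (hρ : Continuous ρ) {β : ℝ} {μ : Measure (LGConfig 2 G)}
    (hμ : μ ∈ infiniteVolumeLimitPoints ρ β) {Fa Fb : LGConfig 2 G → ℝ}
    {Sa Sb : Finset ((Literature.MathematicalPhysics.QuantumLattice.ZdEdge 2))} (hFa : IsCylinder Fa Sa)
    (hFb : IsCylinder Fb Sb) (hca : Continuous Fa) (hcb : Continuous Fb) {Ca Cb : ℝ}
    (hba : ∀ U, |Fa U| ≤ Ca) (hbb : ∀ U, |Fb U| ≤ Cb) {a b a' b' : ℤ} {Ra Ta Rb Tb : ℕ}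
    (hSa : ∀ s ∈ Sa, s.1 ∈ (range Ra ×ˢ range Ta).image
      (fun q : ℕ × ℕ => (![a + q.1, b + q.2] : (Literature.Probability.LatticeModels.Site 2))))
    (hSb : ∀ s ∈ Sb, s.1 ∈ (range Rb ×ˢ range Tb).image
      (fun q : ℕ × ℕ => (![a' + q.1, b' + q.2] : (Literature.Probability.LatticeModels.Site 2))))
    (hgap : a + Ra + 1 ≤ a') : cov[Fa, Fb; μ] = 0 := by
  have t := tendsto_cov_of_mem_two ρ hρ hμ hFa hFb hca hcb hba hbb
  have hle : ∀ δ : ℝ, 0 < δ → |cov[Fa, Fb; μ]| ≤ δ := fun δ hδ =>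
    le_of_tendsto t.abs (eventually_abs_cov_le_of_col_sep ρ hρ β hFa hFb hca hcb hba hbb hSa hSb hgap hδ)
  by_contra h
  have hpos : 0 < |cov[Fa, Fb; μ]| := abs_pos.mpr h
  linarith [hle (|cov[Fa, Fb; μ]| / 2) (by positivity)]

/-- **LOCAL OBSERVABLES A ROW APART ARE EXACTLY UNCORRELATED IN THE INFINITE-VOLUME STATE** (rows `[b, b + Ta)`,
`[b', b' + Tb)`, `b + Ta + 1 ≤ b'`). -/
theorem covariance_eq_zero_of_row_sep (hρ : Continuous ρ) {β : ℝ} {μ : Measure (LGConfig 2 G)}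
    (hμ : μ ∈ infiniteVolumeLimitPoints ρ β) {Fa Fb : LGConfig 2 G → ℝ}
    {Sa Sb : Finset ((Literature.MathematicalPhysics.QuantumLattice.ZdEdge 2))} (hFa : IsCylinder Fa Sa)
    (hFb : IsCylinder Fb Sb) (hca : Continuous Fa) (hcb : Continuous Fb) {Ca Cb : ℝ}
    (hba : ∀ U, |Fa U| ≤ Ca) (hbb : ∀ U, |Fb U| ≤ Cb) {a b a' b' : ℤ} {Ra Ta Rb Tb : ℕ}
    (hSa : ∀ s ∈ Sa, s.1 ∈ (range Ra ×ˢ range Ta).image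
      (fun q : ℕ × ℕ => (![a + q.1, b + q.2] : (Literature.Probability.LatticeModels.Site 2))))
    (hSb : ∀ s ∈ Sb, s.1 ∈ (range Rb ×ˢ range Tb).image
      (fun q : ℕ × ℕ => (![a' + q.1, b' + q.2] : (Literature.Probability.LatticeModels.Site 2))))
    (hgap : b + Ta + 1 ≤ b') : cov[Fa, Fb; μ] = 0 := by
  have t := tendsto_cov_of_mem_two ρ hρ hμ hFa hFb hca hcb hba hbb
  have hle : ∀ δ : ℝ, 0 < δ → |cov[Fa, Fb; μ]| ≤ δ := fun δ hδ =>
    le_of_tendsto t.abs (eventually_abs_cov_le_of_row_sep ρ hρ β hFa hFb hca hcb hba hbb hSa hSb hgap hδ)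
  by_contra h
  have hpos : 0 < |cov[Fa, Fb; μ]| := abs_pos.mpr h
  linarith [hle (|cov[Fa, Fb; μ]| / 2) (by positivity)]

/-- **FINITE-RANGE DEPENDENCE**: with the supports of `F₁`, `F₂` over the boxes `R₁ × T₁` at `(a₁, b₁)` and
`R₂ × T₂` at `(a₂, b₂)`, the covariance `cov_{μ_β}(F₁, F₂ ∘ θ_x)` VANISHES for every translate `x` with
`a₁ + R₁ + 1 ≤ a₂ − x₀` or `a₂ − x₀ + R₂ + 1 ≤ a₁` or `b₁ + T₁ + 1 ≤ b₂ − x₁` or `b₂ − x₁ + T₂ + 1 ≤ b₁`. -/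
theorem covariance_comp_configShift_eq_zero (hρ : Continuous ρ) {β : ℝ} {μ : Measure (LGConfig 2 G)}
    (hμ : μ ∈ infiniteVolumeLimitPoints ρ β) {F₁ F₂ : LGConfig 2 G → ℝ}
    {S₁ S₂ : Finset ((Literature.MathematicalPhysics.QuantumLattice.ZdEdge 2))} (hF₁ : IsCylinder F₁ S₁)
    (hF₂ : IsCylinder F₂ S₂) (hc₁ : Continuous F₁) (hc₂ : Continuous F₂) {C₁ C₂ : ℝ}
    (hb₁ : ∀ U, |F₁ U| ≤ C₁) (hb₂ : ∀ U, |F₂ U| ≤ C₂) {a₁ b₁ a₂ b₂ : ℤ} {R₁ T₁ R₂ T₂ : ℕ}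
    (hS₁ : ∀ s ∈ S₁, s.1 ∈ (range R₁ ×ˢ range T₁).image
      (fun q : ℕ × ℕ => (![a₁ + q.1, b₁ + q.2] : (Literature.Probability.LatticeModels.Site 2))))
    (hS₂ : ∀ s ∈ S₂, s.1 ∈ (range R₂ ×ˢ range T₂).image
      (fun q : ℕ × ℕ => (![a₂ + q.1, b₂ + q.2] : (Literature.Probability.LatticeModels.Site 2))))
    (x : (Literature.Probability.LatticeModels.Site 2))
    (hx : a₁ + R₁ + 1 ≤ a₂ - x 0 ∨ a₂ - x 0 + R₂ + 1 ≤ a₁ ∨ b₁ + T₁ + 1 ≤ b₂ - x 1 ∨ b₂ - x 1 + T₂ + 1 ≤ b₁) :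
    cov[F₁, fun U => F₂ (configShift x U); μ] = 0 := by
  have hF₂x := IsCylinder.comp_configShift hF₂ x
  have hshift : Continuous (configShift (G := G) x) :=
    continuous_pi fun e => by
      simp only [configShift_apply]
      exact continuous_apply _
  have hc₂x : Continuous (F₂ ∘ configShift x) := hc₂.comp hshift
  have hb₂x : ∀ U, |(F₂ ∘ configShift x) U| ≤ C₂ := fun U => hb₂ _
  have hS₂x := sites_image_shift_sub hS₂ x
  have hsymm : cov[F₁, fun U => F₂ (configShift x U); μ] = cov[F₂ ∘ configShift x, F₁; μ] :=
    covariance_comm _ _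
  rcases hx with h | h | h | h
  · exact covariance_eq_zero_of_col_sep ρ hρ hμ hF₁ hF₂x hc₁ hc₂x hb₁ hb₂x hS₁ hS₂x h
  · rw [hsymm]
    exact covariance_eq_zero_of_col_sep ρ hρ hμ hF₂x hF₁ hc₂x hc₁ hb₂x hb₁ hS₂x hS₁ h
  · exact covariance_eq_zero_of_row_sep ρ hρ hμ hF₁ hF₂x hc₁ hc₂x hb₁ hb₂x hS₁ hS₂x h
  · rw [hsymm]
    exact covariance_eq_zero_of_row_sep ρ hρ hμ hF₂x hF₁ hc₂x hc₁ hb₂x hb₁ hS₂x hS₁ h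

end Exact

/-! ## §2. Exponential clustering of the infinite-volume state with every mass -/

section Decay

/-- **EXPONENTIAL CLUSTERING OF THE INFINITE-VOLUME TWO-DIMENSIONAL YANG–MILLS STATE, EVERY COUPLING, EVERY
MASS**: for every infinite-volume limit point `μ` (the unique `μ_β`), every `m > 0` and all bounded
continuous local observables `F₁`, `F₂`:
`HasExponentialDecayRate (x ↦ cov_μ(F₁, F₂ ∘ θ_x)) m` — the clustering clause of
`Literature…osterwalder_seiler_strongCoupling` with no restriction on the coupling, the mass or the
(gauge-)invariance of the observables. -/
theorem hasExponentialDecayRate_covariance_two (hρ : Continuous ρ) {β : ℝ} {μ : Measure (LGConfig 2 G)}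
    (hμ : μ ∈ infiniteVolumeLimitPoints ρ β) {m : ℝ} (hm : 0 < m) {F₁ F₂ : LGConfig 2 G → ℝ}
    (hF₁ : Literature.MathematicalPhysics.QuantumLattice.IsLocalObservable F₁)
    (hF₂ : Literature.MathematicalPhysics.QuantumLattice.IsLocalObservable F₂)
    (hc₁ : Continuous F₁) (hc₂ : Continuous F₂) (hb₁ : ∃ C, ∀ U, |F₁ U| ≤ C) (hb₂ : ∃ C, ∀ U, |F₂ U| ≤ C) :
    Literature.Probability.LatticeModels.HasExponentialDecayRate
      (fun x : (Literature.Probability.LatticeModels.Site 2) => cov[F₁, fun U => F₂ (configShift x U); μ]) m := by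
  obtain ⟨μ₀, hprob, -, huniq, -, -⟩ := exists_infiniteVolumeLimit_two ρ hρ β
  have hμ' := hμ
  rw [huniq, Set.mem_singleton_iff] at hμ'
  subst hμ'
  obtain ⟨C, hC⟩ := torusClustering_two_of_isLocalObservable ρ hρ β hm hF₁ hF₂ hc₁ hc₂ hb₁ hb₂
  obtain ⟨S₁, hS₁⟩ := hF₁
  obtain ⟨S₂, hS₂⟩ := hF₂
  refine ⟨hm, C, fun x => ?_⟩
  exact abs_covariance_le_of_eventually ρ (tendsto_wilsonExpectation_of_mem_two ρ hρ hμ) hS₁ hS₂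
    hc₁.measurable hc₂.measurable hb₁ hb₂ x (hC x)

end Decay

end Summit.Ventures.LatticeQCDFlow.Scoring
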